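import Summits.KontsevichZagierPeriods.KontsevichZagierPeriods.Theorems.KzOnePeriodsG2SDerivation

/-!
# G2S derivations, part 4: the bielliptic quotient `φ_s = (x² + s, y)` and CM partner cycles

Sub-problem `KzOnePeriods` — the theorem of Huber–Wüstholz [cite: HuberWustholz2022, Thm 13.3 (2)
(p. 121)]: every `ℚ̄`-linear relation between 1-periods is a consequence of (R1) bilinearity,
(R2) forms vanishing on the curve, (R3) exactness, (R4) functoriality along morphisms of pairs and
(R5) homotopy [cite: HuberWustholz2022, §13.1 (A)–(B) (p. 120)].  Parts 1–3
(`KzOnePeriodsG2SPlane/Paths/Derivation`) derive inside the `ℚ̄`-span of (R1)–(R5) the relations of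
kz1p's G2S corpus that come from exactness and from the sign involution of the even sextic model
`C_{a,b,c} : y² = f(x) = x⁶ + a x⁴ + b x² + c`.  This part derives the relations that come from its
**bielliptic structure**:

* **(R4) modulo (R2)** (`span_image_of_formPullback_vanish`): if `f : Z → Z′` is a polynomial map
  over `ℚ̄`, `f^*ω′ − u·ω` vanishes on the tangent lines of `Z` (it need not vanish as a polynomial),
  `u ∈ ℚ̄` and `γ′ = f ∘ γ` on `[0, 1]`, then `(Z′, ω′, γ′) − u·(Z, ω, γ)` is the combination
  `(R1: f^*ω′ = ν + u·ω) + (R2: ν) − (R4) + (R1: u·ω)` of elementary relations.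
* **The quotient map** `φ_s = (x² + s, y) : C_{a,b,c} → E_{A,B} : Y² = X³ + AX + B`, defined when
  `f(x) = F(x² + s)`, i.e. `a = 3s, b = 3s² + A, c = s³ + As + B` (`Split`), and the congruence
  `φ_s^*(dX/Y) ≡ 2x dx/y = 4·θ_x` on `C` (`vanishes_phi_theta0`: checked on every tangent line,
  including those at the six branch points `y = 0`, from the two Bézout identities); hence
  `(E, θ₀, φ_s∘γ) − 4·(C, θ_x, γ) ∈ ⟨(R1)–(R5)⟩_ℚ̄` (`span_phi`).
* **CM partner cycles** (`span_cmPartner`, `relation_cmPartner`): for `B = 0` (`E_{A,0}`, `j = 1728`,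
  CM by `[d] = (X, Y) ↦ (−X, dY)`, `d² = −1`) and two paths `γ₁, γ₂` on `C` with
  `x₂² + s = −(x₁² + s)` and `y₂ = d·y₁` on `[0, 1]` — so that `φ_s∘γ₂ = [d]∘φ_s∘γ₁` — the symbol
  `(C, θ_x, γ₂) − d·(C, θ_x, γ₁)` lies in the span and `∫_{γ₂} x dx/2y = d·∫_{γ₁} x dx/2y`.
  This is the shape of corpus relation G2-01 (`C₆ : y² = (x²−18)(x²−24)(x²−30)`, `s = −24`,
  `E : Y² = X³ − 36X`, `∫_{c₂₃⁺} x dx/2y = i·∫_{c₁₂⁺} x dx/2y`).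

All statements quantify over `C¹` paths with algebraic end points (`CurvePath`); part 5 constructs
kz1p's real ovals and their CM partners as such paths.  No definitions (local notation only), no new
axioms; no statement of the programme is cited — the one citation is the published theorem whose
relation span is instantiated.
-/

noncomputable section

open MvPolynomial Set Complex Filter Topology
open Literature.NumberTheory.Transcendental Literature.NumberTheory.Transcendental.CurvePeriods
open Summit.KontsevichZagierPeriods.KzOnePeriods.E1Derivation

namespace Summit.KontsevichZagierPeriods.KzOnePeriods.G2SDerivation

local notation3 "InSpanRel " c:arg => ∃ (k : ℕ) (ρ : Fin k → (PeriodSymbol →₀ ℂ))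
  (a : Fin k → ℂ), (∀ l, IsElementaryRelation (ρ l)) ∧ (∀ l, IsAlgebraic ℚ (a l)) ∧
    c = ∑ l, a l • ρ l

/-- The symbol `(Z, ω, γ)` as an element of the formal period space. -/
local notation3 (prettyPrint := false) "Sy[" Z ", " hZ ", " ω ", " h ", " γ "]" =>
  (Finsupp.single (⟨Z, hZ, ω, h, γ⟩ : PeriodSymbol) (1 : ℂ) : PeriodSymbol →₀ ℂ)

/-- The period `∫_γ ω` of the symbol `(Z, ω, γ)`. -/
local notation3 (prettyPrint := false) "Pe[" Z ", " hZ ", " ω ", " h ", " γ "]" =>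
  PeriodSymbol.period (⟨Z, hZ, ω, h, γ⟩ : PeriodSymbol)

/-- The even sextic `f = x⁶ + a x⁴ + b x² + c ∈ ℂ[x, y]`. -/
local notation3 (prettyPrint := false) "fS[" a ", " b ", " c "]" =>
  ((X 0 : MvPolynomial (Fin 2) ℂ) ^ 6 + C a * X 0 ^ 4 + C b * X 0 ^ 2 + C c)

/-- The affine plane model `C_{a,b,c} = {y² = f(x)} ⊂ 𝔸²`. -/
local notation3 (prettyPrint := false) "Cpl[" a ", " b ", " c "]" =>
  (⟨2, 1, ![(X 1 : MvPolynomial (Fin 2) ℂ) ^ 2 - fS[a, b, c]]⟩ : CurveData)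

/-- The polynomial `Σ_k π_k x^k ∈ ℂ[x, y]` with coefficient vector `π`. -/
local notation3 (prettyPrint := false) "Pol[" π "]" =>
  (∑ k, C (π k) * (X 0 : MvPolynomial (Fin 2) ℂ) ^ (k : ℕ))

/-- The even polynomial `U = Σ_{k<3} μ_k x^{2k}` (Bézout cofactor of `f`). -/
local notation3 (prettyPrint := false) "Upol[" μ "]" =>
  (∑ k : Fin 3, C (μ k) * (X 0 : MvPolynomial (Fin 2) ℂ) ^ (2 * (k : ℕ)))

/-- The odd polynomial `V = Σ_{k<3} ν_k x^{2k+1}` (Bézout cofactor of `f′`). -/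
local notation3 (prettyPrint := false) "Vpol[" ν "]" =>
  (∑ k : Fin 3, C (ν k) * (X 0 : MvPolynomial (Fin 2) ℂ) ^ (2 * (k : ℕ) + 1))

/-- `θ[μ, ν, π] = (½ P U y) dx + (P V) dy`, the polynomial representative of `P(x) dx/(2y)`. -/
local notation3 (prettyPrint := false) "θ[" μ ", " ν ", " π "]" =>
  (![C (1 / 2 : ℂ) * Pol[π] * Upol[μ] * X 1, Pol[π] * Vpol[ν]] :
    Fin 2 → MvPolynomial (Fin 2) ℂ)

/-- The Bézout identity `U f + V f′ = 1` (scalar form). -/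
local notation3 (prettyPrint := false) "Bez[" a ", " b ", " c ", " μ ", " ν "]" =>
  (∀ x : ℂ, (∑ k : Fin 3, μ k * x ^ (2 * (k : ℕ))) * (x ^ 6 + a * x ^ 4 + b * x ^ 2 + c) +
    (∑ k : Fin 3, ν k * x ^ (2 * (k : ℕ) + 1)) * (6 * x ^ 5 + 4 * a * x ^ 3 + 2 * b * x) = 1)

/-- `P = x` (scalar form): `θ[μ, ν, π]` is then `θ_x`, the representative of `x dx/(2y)`. -/
local notation3 (prettyPrint := false) "IsX[" π "]" => (∀ x : ℂ, ∑ k, π k * x ^ (k : ℕ) = x)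

/-- The bielliptic quotient map `φ_s = (x² + s, y)` as a polynomial map of the plane. -/
local notation3 (prettyPrint := false) "phi[" s "]" =>
  (![X 0 ^ 2 + C s, X 1] : Fin 2 → MvPolynomial (Fin 2) ℂ)

/-- `f(x) = F(x² + s)` with `F = X³ + AX + B`: the even sextic factors through `X = x² + s`. -/
local notation3 (prettyPrint := false) "Split[" a ", " b ", " c ", " s ", " A ", " B "]" =>
  ((a : ℂ) = 3 * s ∧ (b : ℂ) = 3 * s ^ 2 + A ∧ (c : ℂ) = s ^ 3 + A * s + B)

variable {a b c : ℂ}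

/-! ### (R4) modulo (R2): pushing forward a form that is an eigenform only on the curve -/

/-- **(R1) + (R2) + (R4).**  If `f : Z → Z′` is a polynomial map over `ℚ̄`, the form `f^*ω′ − u·ω`
vanishes on `Z`, `u ∈ ℚ̄`, and `γ′ = f ∘ γ` on `[0, 1]`, then `(Z′, ω′, γ′) − u·(Z, ω, γ) ∈ ⟨(R1)–(R5)⟩_ℚ̄`. -/
theorem span_image_of_formPullback_vanish {Z Z' : CurveData} (hZ : Z.IsSmoothAffineCurve)
    (hZ' : Z'.IsSmoothAffineCurve) (f : Fin Z'.n → MvPolynomial (Fin Z.n) ℂ)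
    (hf : ∀ j, HasAlgCoeffs (f j)) (hfZ : ∀ z ∈ Z.points, (fun j => eval z (f j)) ∈ Z'.points)
    (ω' : Fin Z'.n → MvPolynomial (Fin Z'.n) ℂ) (h' : ∀ j, HasAlgCoeffs (ω' j))
    (ω : Fin Z.n → MvPolynomial (Fin Z.n) ℂ) (h : ∀ i, HasAlgCoeffs (ω i)) {u : ℂ}
    (hu : IsAlgebraic ℚ u) (hv : VanishesOn Z (formPullback f ω' - u • ω)) {γ : CurvePath Z}
    {γ' : CurvePath Z'} (hγ' : ∀ t ∈ Icc (0 : ℝ) 1, γ'.toFun t = fun j => eval (γ.toFun t) (f j)) :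
    InSpanRel (Sy[Z', hZ', ω', h', γ'] - u • Sy[Z, hZ, ω, h, γ]) := by
  have hfω : ∀ i, HasAlgCoeffs (formPullback f ω' i) := HasAlgCoeffs.formPullback hf h'
  have huω : ∀ i, HasAlgCoeffs ((u • ω) i) := fun i => (h i).smul hu
  have hν : ∀ i, HasAlgCoeffs ((formPullback f ω' - u • ω) i) := fun i => (hfω i).sub (huω i)
  have r₁ := IsElementaryRelation.pushforward Z Z' hZ hZ' f hf hfZ ω' h' (formPullback f ω') hfω
    rfl γ γ' hγ'
  have r₂ := IsElementaryRelation.add Z hZ γ (formPullback f ω') (formPullback f ω' - u • ω)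
    (u • ω) hfω hν huω (sub_add_cancel _ _).symm
  have r₃ := IsElementaryRelation.vanish Z hZ γ (formPullback f ω' - u • ω) hν hv
  have r₄ := IsElementaryRelation.smul Z hZ γ u hu ω (u • ω) h huω rfl
  obtain ⟨k, ρ, w, hρ, hw, hs⟩ := span_add
    (span_sub (span_add (span_of_rel r₂) (span_of_rel r₃)) (span_of_rel r₁)) (span_of_rel r₄)
  exact ⟨k, ρ, w, hρ, hw, by rw [← hs]; abel⟩

/-- … and then `∫_{γ′} ω′ = u·∫_γ ω`, by the soundness of (R1)–(R5). -/
theorem image_of_formPullback_vanish {Z Z' : CurveData} (hZ : Z.IsSmoothAffineCurve)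
    (hZ' : Z'.IsSmoothAffineCurve) (f : Fin Z'.n → MvPolynomial (Fin Z.n) ℂ)
    (hf : ∀ j, HasAlgCoeffs (f j)) (hfZ : ∀ z ∈ Z.points, (fun j => eval z (f j)) ∈ Z'.points)
    (ω' : Fin Z'.n → MvPolynomial (Fin Z'.n) ℂ) (h' : ∀ j, HasAlgCoeffs (ω' j))
    (ω : Fin Z.n → MvPolynomial (Fin Z.n) ℂ) (h : ∀ i, HasAlgCoeffs (ω i)) {u : ℂ}
    (hu : IsAlgebraic ℚ u) (hv : VanishesOn Z (formPullback f ω' - u • ω)) {γ : CurvePath Z}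
    {γ' : CurvePath Z'} (hγ' : ∀ t ∈ Icc (0 : ℝ) 1, γ'.toFun t = fun j => eval (γ.toFun t) (f j)) :
    Pe[Z', hZ', ω', h', γ'] = u * Pe[Z, hZ, ω, h, γ] := by
  obtain ⟨k, ρ, w, hρ, hw, hc⟩ := span_image_of_formPullback_vanish hZ hZ' f hf hfZ ω' h' ω h hu hv hγ'
  have h0 := evalCombination_eq_zero_of_isElementaryRelation ρ w hρ
  rw [← hc, sub_eq_add_neg, ← neg_smul, evalCombination_add, evalCombination_smul,
    evalCombination_single, evalCombination_single] at h0
  linear_combination h0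

/-! ### The quotient map `φ_s = (x² + s, y) : C_{a,b,c} → E_{A,B}` -/

/-- `φ_s` is defined over `ℚ̄` for `s ∈ ℚ̄`. -/
theorem hasAlgCoeffs_phi {s : ℂ} (hs : IsAlgebraic ℚ s) : ∀ j, HasAlgCoeffs ((phi[s]) j) := fun j => by
  fin_cases j
  · simpa using ((hasAlgCoeffs_X (n := 2) 0).pow 2).add (hasAlgCoeffs_C hs)
  · simpa using hasAlgCoeffs_X (n := 2) 1

/-- `φ_s(z) = (z₀² + s, z₁)`. -/
theorem eval_phi (s : ℂ) (z : Fin 2 → ℂ) :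
    (fun j => eval z ((phi[s]) j)) = ![z 0 ^ 2 + s, z 1] := by
  funext j
  fin_cases j <;> simp

/-- The Jacobian of `φ_s` at `z`: `∂φ₀/∂x = 2z₀`, `∂φ₁/∂y = 1`, the other two entries `0`. -/
theorem eval_pderiv_phi (s : ℂ) (z : Fin 2 → ℂ) (i j : Fin 2) :
    eval z (pderiv i ((phi[s]) j)) = (![![2 * z 0, 0], ![0, 1]] : Fin 2 → Fin 2 → ℂ) i j := by
  fin_cases i <;> fin_cases j <;>
    simp [Derivation.leibniz_pow, pderiv_X_of_ne (show (0 : Fin 2) ≠ 1 by decide),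
      pderiv_X_of_ne (show (1 : Fin 2) ≠ 0 by decide), smul_eq_mul, nsmul_eq_mul]

/-- The chain rule for `φ_s`: `(φ_s^*ω′)(z)(v) = ω′(φ_s z)(2z₀v₀, v₁)`. -/
theorem phi_pair (s : ℂ) (ω' : Fin 2 → MvPolynomial (Fin 2) ℂ) (z v : Fin 2 → ℂ) :
    ∑ i, eval z (formPullback (phi[s]) ω' i) * v i =
      eval (![z 0 ^ 2 + s, z 1]) (ω' 0) * (2 * z 0 * v 0) +
        eval (![z 0 ^ 2 + s, z 1]) (ω' 1) * v 1 := by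
  simp only [Fin.sum_univ_two, formPullback_two, map_add, map_mul, eval_bind₁_eq, eval_pderiv_phi]
  rw [eval_phi]
  simp only [Matrix.cons_val_zero, Matrix.cons_val_one]
  ring

/-- `φ_s` maps `C_{a,b,c}` into `E_{A,B}` when `f(x) = F(x² + s)`. -/
theorem phi_mem {s A B : ℂ} (hsp : Split[a, b, c, s, A, B]) :
    ∀ z ∈ Cpl[a, b, c].points, (fun j => eval z ((phi[s]) j)) ∈ (weierCurve A B).points := by
  intro z hz
  obtain ⟨ha, hb, hc⟩ := hsp
  rw [mem_points_iff] at hz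
  rw [eval_phi, Weier.mem_points_iff, Weier.eval_fPoly]
  simp only [Matrix.cons_val_zero, Matrix.cons_val_one]
  rw [hz, ha, hb, hc]
  ring

/-- **The image path** `φ_s ∘ γ = ((x∘γ)² + s, y∘γ)` is a `C¹` path on `E_{A,B}` with algebraic end
points, for every such path `γ` on `C_{a,b,c}`. -/
theorem exists_phiPath {s A B : ℂ} (hs : IsAlgebraic ℚ s) (hsp : Split[a, b, c, s, A, B])
    (γ : CurvePath Cpl[a, b, c]) :
    ∃ γ' : CurvePath (weierCurve A B), ∀ t, γ'.toFun t = ![γ.toFun t 0 ^ 2 + s, γ.toFun t 1] :=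
  (exists_imagePath (Z := Cpl[a, b, c]) (Z' := weierCurve A B) (phi[s]) (hasAlgCoeffs_phi hs)
    (phi_mem hsp) γ).imp fun _ h t => (h t).trans (eval_phi s _)

/-- **`φ_s^*(dX/Y) ≡ 2x dx/y` on `C_{a,b,c}`.**  With `θ₀ = θ₀[A, B]` the polynomial representative of
`dX/Y` on `E_{A,B}` (`CurvePeriodsEllipticFormsProofs`) and `θ[μ, ν, π]`, `P = x`, that of `x dx/(2y)`
on `C_{a,b,c}` (`U f + V f′ = 1`), the form `φ_s^*θ₀ − 4·θ_x` vanishes on every tangent line of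
`C_{a,b,c}`: at the points `y ≠ 0` both forms restrict to `2x dx/y`; at the branch points `y = 0` the
tangent line is `dx = 0` and the `dy`-coefficients agree, `(2/D)·V_E(x² + s) = 2/F′(x² + s) =
4x/f′(x) = 4x·V(x)`, by the Bézout identities of `E` (`V_E F′ − U_E F = D`) and of `C`. -/
theorem vanishes_phi_theta0 {s A B : ℂ} (hsp : Split[a, b, c, s, A, B]) (hD : Weier.disc A B ≠ 0)
    {μ ν : Fin 3 → ℂ} (hbez : Bez[a, b, c, μ, ν]) {N : ℕ} {π : Fin N → ℂ} (hπ : IsX[π]) :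
    VanishesOn Cpl[a, b, c] (formPullback (phi[s]) (Weier.theta0 A B) - (4 : ℂ) • θ[μ, ν, π]) := by
  obtain ⟨rfl, rfl, rfl⟩ := hsp
  intro z hz v hv
  rw [mem_points_iff] at hz
  rw [mem_tangentSpace_iff] at hv
  have hB := hbez (z 0)
  have hP := hπ (z 0)
  have hT : Weier.disc A B * (1 / Weier.disc A B) = 1 := mul_one_div_cancel hD
  have hBE : (6 * A * (z 0 ^ 2 + s) ^ 2 - 9 * B * (z 0 ^ 2 + s) + 4 * A ^ 2) *
      (3 * (z 0 ^ 2 + s) ^ 2 + A) - (18 * A * (z 0 ^ 2 + s) - 27 * B) *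
      ((z 0 ^ 2 + s) ^ 3 + A * (z 0 ^ 2 + s) + B) = Weier.disc A B := by
    simp only [Weier.disc]; ring
  have cancel : ∀ {q w : ℂ}, q ≠ 0 → q * w = 0 → w = 0 := fun hq h =>
    (mul_eq_zero.1 h).resolve_left hq
  -- split `Σ_i` into the pull-back pairing and the pairing of `4·θ_x`
  have hsplit : ∑ i, eval z ((formPullback (phi[s]) (Weier.theta0 A B) - (4 : ℂ) • θ[μ, ν, π]) i) * v i =
      (∑ i, eval z (formPullback (phi[s]) (Weier.theta0 A B) i) * v i) -
        4 * (eval z (θ[μ, ν, π] 0) * v 0 + eval z (θ[μ, ν, π] 1) * v 1) := by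
    simp only [Fin.sum_univ_two, Pi.sub_apply, Pi.smul_apply, map_sub, smul_eval]
    ring
  rw [hsplit, phi_pair]
  simp only [Weier.theta0, Weier.uPol, Weier.vPol, Matrix.cons_val_zero, Matrix.cons_val_one,
    map_mul, map_sub, map_add, map_pow, eval_C, eval_X, eval_Pol, eval_Upol, eval_Vpol, hP]
  set U := ∑ k : Fin 3, μ k * z 0 ^ (2 * (k : ℕ)) with hU
  set V := ∑ k : Fin 3, ν k * z 0 ^ (2 * (k : ℕ) + 1) with hV
  by_cases hy : z 1 = 0
  · -- branch point: `f(z₀) = 0`, so `V f′ = 1` and `f′(z₀) ≠ 0`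
    have hf0 : z 0 ^ 6 + 3 * s * z 0 ^ 4 + (3 * s ^ 2 + A) * z 0 ^ 2 + (s ^ 3 + A * s + B) = 0 := by
      linear_combination -hz + z 1 * hy
    have hVf : V * (6 * z 0 ^ 5 + 4 * (3 * s) * z 0 ^ 3 + 2 * (3 * s ^ 2 + A) * z 0) = 1 := by
      linear_combination hB - U * hf0
    have hf' : (6 * z 0 ^ 5 + 4 * (3 * s) * z 0 ^ 3 + 2 * (3 * s ^ 2 + A) * z 0) ≠ 0 := fun h0 =>
      zero_ne_one (by linear_combination hVf - V * h0)
    refine cancel (mul_ne_zero hf' hD) ?_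
    linear_combination
      ((6 * z 0 ^ 5 + 4 * (3 * s) * z 0 ^ 3 + 2 * (3 * s ^ 2 + A) * z 0) *
          (-2 * (18 * A * (z 0 ^ 2 + s) - 27 * B) * z 0 * z 1 * v 0 +
            2 * (6 * A * (z 0 ^ 2 + s) ^ 2 - 9 * B * (z 0 ^ 2 + s) + 4 * A ^ 2) * v 1)) * hT +
      ((6 * z 0 ^ 5 + 4 * (3 * s) * z 0 ^ 3 + 2 * (3 * s ^ 2 + A) * z 0) * z 0 * v 0 *
            (-2 * (18 * A * (z 0 ^ 2 + s) - 27 * B) - 2 * Weier.disc A B * U) +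
          (4 * z 0 * (18 * A * (z 0 ^ 2 + s) - 27 * B) + 4 * Weier.disc A B * z 0 * U) * v 1 * z 1) * hy +
      (4 * z 0 * v 1) * hBE -
      ((4 * z 0 * (18 * A * (z 0 ^ 2 + s) - 27 * B) + 4 * Weier.disc A B * z 0 * U) * v 1) * hz -
      (4 * Weier.disc A B * z 0 * v 1) * hB
  · -- ordinary point: multiply by `2 z₁ D` and use the tangent equation
    refine cancel (mul_ne_zero (mul_ne_zero two_ne_zero hy) hD) ?_
    linear_combination
      (v 0 * (-4 * (18 * A * (z 0 ^ 2 + s) - 27 * B) * z 0 - 4 * Weier.disc A B * z 0 * U)) * hz +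
      (4 * z 0 * v 0) * hBE + (-4 * Weier.disc A B * z 0 * v 0) * hB +
      (2 * (6 * A * (z 0 ^ 2 + s) ^ 2 - 9 * B * (z 0 ^ 2 + s) + 4 * A ^ 2) -
          4 * Weier.disc A B * z 0 * V) * hv +
      (2 * z 1 * (-2 * (18 * A * (z 0 ^ 2 + s) - 27 * B) * z 0 * z 1 * v 0 +
          2 * (6 * A * (z 0 ^ 2 + s) ^ 2 - 9 * B * (z 0 ^ 2 + s) + 4 * A ^ 2) * v 1)) * hT

/-- **The bielliptic derivation** `(E_{A,B}, θ₀, γ′) − 4·(C_{a,b,c}, θ_x, γ) ∈ ⟨(R1)–(R5)⟩_ℚ̄` for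
every path `γ` on `C_{a,b,c}` and `γ′ = φ_s ∘ γ` on `[0, 1]` (`A, B, s ∈ ℚ̄`, `4A³ + 27B² ≠ 0`). -/
theorem span_phi (ha : IsAlgebraic ℚ a) (hb : IsAlgebraic ℚ b) (hc : IsAlgebraic ℚ c)
    {μ ν : Fin 3 → ℂ} (hμ : ∀ k, IsAlgebraic ℚ (μ k)) (hν : ∀ k, IsAlgebraic ℚ (ν k))
    (hbez : Bez[a, b, c, μ, ν]) {N : ℕ} {π : Fin N → ℂ} (hπa : ∀ k, IsAlgebraic ℚ (π k))
    (hπ : IsX[π]) {s A B : ℂ} (hs : IsAlgebraic ℚ s) (hA : IsAlgebraic ℚ A) (hB : IsAlgebraic ℚ B)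
    (hD : Weier.disc A B ≠ 0) (hsp : Split[a, b, c, s, A, B]) {γ : CurvePath Cpl[a, b, c]}
    {γ' : CurvePath (weierCurve A B)}
    (hγ' : ∀ t ∈ Icc (0 : ℝ) 1, γ'.toFun t = ![γ.toFun t 0 ^ 2 + s, γ.toFun t 1]) :
    InSpanRel (Sy[weierCurve A B, Weier.isSmoothAffineCurve A B hA hB hD, Weier.theta0 A B,
        Weier.hasAlgCoeffs_theta0 A B hA hB, γ'] -
      (4 : ℂ) • Sy[Cpl[a, b, c], smooth ha hb hc hbez, θ[μ, ν, π], hasAlgCoeffs_theta hμ hν hπa, γ]) := by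
  have h4 : IsAlgebraic ℚ (4 : ℂ) := by exact_mod_cast isAlgebraic_nat 4
  exact span_image_of_formPullback_vanish (smooth ha hb hc hbez)
    (Weier.isSmoothAffineCurve A B hA hB hD) (phi[s]) (hasAlgCoeffs_phi hs) (phi_mem hsp)
    (Weier.theta0 A B) (Weier.hasAlgCoeffs_theta0 A B hA hB) θ[μ, ν, π]
    (hasAlgCoeffs_theta hμ hν hπa) h4 (vanishes_phi_theta0 hsp hD hbez hπ)
    fun t ht => (hγ' t ht).trans (eval_phi s _).symm

/-- … and `∫_{φ_s∘γ} dX/Y = 4·∫_γ θ_x` (`= 2 ∫_γ x dx/y`). -/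
theorem relation_phi (ha : IsAlgebraic ℚ a) (hb : IsAlgebraic ℚ b) (hc : IsAlgebraic ℚ c)
    {μ ν : Fin 3 → ℂ} (hμ : ∀ k, IsAlgebraic ℚ (μ k)) (hν : ∀ k, IsAlgebraic ℚ (ν k))
    (hbez : Bez[a, b, c, μ, ν]) {N : ℕ} {π : Fin N → ℂ} (hπa : ∀ k, IsAlgebraic ℚ (π k))
    (hπ : IsX[π]) {s A B : ℂ} (hs : IsAlgebraic ℚ s) (hA : IsAlgebraic ℚ A) (hB : IsAlgebraic ℚ B)
    (hD : Weier.disc A B ≠ 0) (hsp : Split[a, b, c, s, A, B]) {γ : CurvePath Cpl[a, b, c]}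
    {γ' : CurvePath (weierCurve A B)}
    (hγ' : ∀ t ∈ Icc (0 : ℝ) 1, γ'.toFun t = ![γ.toFun t 0 ^ 2 + s, γ.toFun t 1]) :
    Pe[weierCurve A B, Weier.isSmoothAffineCurve A B hA hB hD, Weier.theta0 A B,
        Weier.hasAlgCoeffs_theta0 A B hA hB, γ'] =
      4 * Pe[Cpl[a, b, c], smooth ha hb hc hbez, θ[μ, ν, π], hasAlgCoeffs_theta hμ hν hπa, γ] := by
  have h4 : IsAlgebraic ℚ (4 : ℂ) := by exact_mod_cast isAlgebraic_nat 4
  exact image_of_formPullback_vanish (smooth ha hb hc hbez)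
    (Weier.isSmoothAffineCurve A B hA hB hD) (phi[s]) (hasAlgCoeffs_phi hs) (phi_mem hsp)
    (Weier.theta0 A B) (Weier.hasAlgCoeffs_theta0 A B hA hB) θ[μ, ν, π]
    (hasAlgCoeffs_theta hμ hν hπa) h4 (vanishes_phi_theta0 hsp hD hbez hπ)
    fun t ht => (hγ' t ht).trans (eval_phi s _).symm

/-! ### CM partner cycles (`B = 0`: `E_{A,0}` has CM by `[d] = (X, Y) ↦ (−X, dY)`, `d² = −1`) -/

/-- **CM partner cycles on a bielliptic genus-2 curve.**  Let `f(x) = F(x² + s)` with `F = X³ + AX`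
(`A ∈ ℚ̄`, `A ≠ 0`), `d² = −1`, and let `γ₁, γ₂` be paths on `C_{a,b,c}` with `x₂² + s = −(x₁² + s)` and
`y₂ = d·y₁` on `[0, 1]`, so that `φ_s∘γ₂ = [d]∘(φ_s∘γ₁)` on `E_{A,0}`.  Then
`(C, θ_x, γ₂) − d·(C, θ_x, γ₁) ∈ ⟨(R1)–(R5)⟩_ℚ̄`: it is `¼·{([d] on E) − (φ_s, γ₂) + d·(φ_s, γ₁)}` of the
three derivations `cmI_derivations`, `span_phi`, `span_phi`. -/
theorem span_cmPartner (ha : IsAlgebraic ℚ a) (hb : IsAlgebraic ℚ b) (hc : IsAlgebraic ℚ c)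
    {μ ν : Fin 3 → ℂ} (hμ : ∀ k, IsAlgebraic ℚ (μ k)) (hν : ∀ k, IsAlgebraic ℚ (ν k))
    (hbez : Bez[a, b, c, μ, ν]) {N : ℕ} {π : Fin N → ℂ} (hπa : ∀ k, IsAlgebraic ℚ (π k))
    (hπ : IsX[π]) {s A : ℂ} (hs : IsAlgebraic ℚ s) (hA : IsAlgebraic ℚ A) (hA0 : A ≠ 0)
    (hsp : Split[a, b, c, s, A, 0]) {d : ℂ} (hd : d ^ 2 = -1) {γ₁ γ₂ : CurvePath Cpl[a, b, c]}
    (h₁₂ : ∀ t ∈ Icc (0 : ℝ) 1, γ₂.toFun t 0 ^ 2 + s = -(γ₁.toFun t 0 ^ 2 + s) ∧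
      γ₂.toFun t 1 = d * γ₁.toFun t 1) :
    InSpanRel (Sy[Cpl[a, b, c], smooth ha hb hc hbez, θ[μ, ν, π], hasAlgCoeffs_theta hμ hν hπa, γ₂] -
      d • Sy[Cpl[a, b, c], smooth ha hb hc hbez, θ[μ, ν, π], hasAlgCoeffs_theta hμ hν hπa, γ₁]) := by
  have hD : Weier.disc A 0 ≠ 0 := disc_ne_zero_left hA0
  have hE := Weier.isSmoothAffineCurve A 0 hA isAlgebraic_zero hD
  have hθ := Weier.hasAlgCoeffs_theta0 A 0 hA isAlgebraic_zero
  have hxθ := Weier.hasAlgCoeffs_smul_theta0 A 0 hA isAlgebraic_zero (hasAlgCoeffs_X 0)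
  obtain ⟨γ₁', h₁⟩ := exists_phiPath hs hsp γ₁
  obtain ⟨γ₂', h₂⟩ := exists_phiPath hs hsp γ₂
  have hcm : ∀ t ∈ Icc (0 : ℝ) 1, γ₂'.toFun t = ![-γ₁'.toFun t 0, d * γ₁'.toFun t 1] := by
    intro t ht
    obtain ⟨hx, hy⟩ := h₁₂ t ht
    rw [h₂ t, h₁ t]
    simp only [Matrix.cons_val_zero, Matrix.cons_val_one]
    rw [hx, hy]
  have key := (cmI_derivations hd hE hθ hxθ hcm).1.1
  have p₁ := span_phi ha hb hc hμ hν hbez hπa hπ hs hA isAlgebraic_zero hD hsp (γ := γ₁)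
    (γ' := γ₁') fun t _ => h₁ t
  have p₂ := span_phi ha hb hc hμ hν hbez hπa hπ hs hA isAlgebraic_zero hD hsp (γ := γ₂)
    (γ' := γ₂') fun t _ => h₂ t
  have h4 : IsAlgebraic ℚ (1 / 4 : ℂ) := by
    rw [one_div]; exact (isAlgebraic_nat 4).inv
  obtain ⟨k, ρ, w, hρ, hw, hs'⟩ := span_smul h4
    (span_add (span_sub key p₂) (span_smul (isAlgebraic_of_sq_eq_neg_one hd) p₁))
  refine ⟨k, ρ, w, hρ, hw, ?_⟩
  rw [← hs']
  module

/-- … and `∫_{γ₂} x dx/2y = d·∫_{γ₁} x dx/2y`. -/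
theorem relation_cmPartner (ha : IsAlgebraic ℚ a) (hb : IsAlgebraic ℚ b) (hc : IsAlgebraic ℚ c)
    {μ ν : Fin 3 → ℂ} (hμ : ∀ k, IsAlgebraic ℚ (μ k)) (hν : ∀ k, IsAlgebraic ℚ (ν k))
    (hbez : Bez[a, b, c, μ, ν]) {N : ℕ} {π : Fin N → ℂ} (hπa : ∀ k, IsAlgebraic ℚ (π k))
    (hπ : IsX[π]) {s A : ℂ} (hs : IsAlgebraic ℚ s) (hA : IsAlgebraic ℚ A) (hA0 : A ≠ 0)
    (hsp : Split[a, b, c, s, A, 0]) {d : ℂ} (hd : d ^ 2 = -1) {γ₁ γ₂ : CurvePath Cpl[a, b, c]}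
    (h₁₂ : ∀ t ∈ Icc (0 : ℝ) 1, γ₂.toFun t 0 ^ 2 + s = -(γ₁.toFun t 0 ^ 2 + s) ∧
      γ₂.toFun t 1 = d * γ₁.toFun t 1) :
    Pe[Cpl[a, b, c], smooth ha hb hc hbez, θ[μ, ν, π], hasAlgCoeffs_theta hμ hν hπa, γ₂] =
      d * Pe[Cpl[a, b, c], smooth ha hb hc hbez, θ[μ, ν, π], hasAlgCoeffs_theta hμ hν hπa, γ₁] := by
  obtain ⟨k, ρ, w, hρ, hw, hc'⟩ := span_cmPartner ha hb hc hμ hν hbez hπa hπ hs hA hA0 hsp hd h₁₂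
  have h0 := evalCombination_eq_zero_of_isElementaryRelation ρ w hρ
  rw [← hc', sub_eq_add_neg, ← neg_smul, evalCombination_add, evalCombination_smul,
    evalCombination_single, evalCombination_single] at h0
  linear_combination h0

end Summit.KontsevichZagierPeriods.KzOnePeriods.G2SDerivation

end
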